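import Mathlib
import Summits.CriticalPhenomena.PercolationContinuityZ3.Theorems.PercNearOneGluingNoHeavyLowerTailTwoPetalGame

/-!
# Two-petal order-shattering domination (hp-7 gen 83): a quantifier-game strengthening of the Harris–Kleitman / two-petal K♯ inequality

Helper file for crux `stmt-CriticalPhenomena-4575` (`NoHeavyLowerTail`, route `PercNearOneGluingNoHeavy`), hull-port seat `prim-hp-7`
(generation 83); `--supports stmt-CriticalPhenomena-4575`.  Pure finite set theory; everything is PROVED.
Memo: `run/shared/lean/prim/prim-hp-7/FROM-prim-hp-7-g83-GAME-COUNT.md` §0quater (U).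

**Theorem (`force_twoPetal`).**  Let `P, Q` be up-sets of subsets of a ground set `U` and put
`disagree = {t : (t ∈ P ∧ U \\ t ∈ Q) ∨ (t ∈ Q ∧ U \\ t ∈ P)}` and `agree = {t : (t ∈ P ∧ t ∈ Q) ∨ (U \\ t ∈ P ∧ U \\ t ∈ Q)}`.
For EVERY play order / quantifier pattern `lg` enumerating `U` (game `TwoPetalGame.Force`, gen 83): if Verifier can force `disagree`
she can force `agree`.  For the two petals of a monotone pair `(g,h)` these are the debtor resp. resolved families, so this is the
two-petal case of the gen-83 debtor-game conjecture in its strongest (every-order) form; counting won quantifier words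
(`…LowerTailGameCount`) recovers `#disagree ≤ #agree` (Harris–Kleitman, `kSharp_two`).  Three petals fail in some orders from `n = 6`
(memo §0 (D)); the proof locates why (memo §0quater (V): with three petals the 'colour' below can drift around the hexagon).

**Proof.**  Verifier follows a `disagree`-winning strategy and switches to the constant strategy `1` (resp. `0`) as soon as
`F = ones ∪ (her remaining coordinates)` (resp. `G = zeros ∪ (her remaining coordinates)`) lies in `P ∩ Q`.  If no switch is ever
available, the all-`0` / all-`1` continuations of the winning strategy show `F, G ∈ P ∪ Q`, hence each lies in exactly one of
`P, Q`; one coordinate enters or leaves at a time, so this colour never changes (`key_*` steps), and `F = G` at the start — but at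
the end `F = s`, `G = U \\ s` with `s` disagreeing and not agreeing have different colours.  Formally: induction on the remaining game
with the invariant `Good` (`force_twoPetal_aux`).
-/

namespace Summit.CriticalPhenomena.PercolationContinuityZ3.Theorems

namespace TwoPetalGame

open Finset

variable {α : Type*} [DecidableEq α]

/-! ### The two-petal theorem -/

section TwoPetal

variable (U : Finset α) (P Q : Finset (Finset α))

/-- `P` is an up-set of subsets of the ground set `U`. -/
def IsUpperIn : Prop := ∀ ⦃s t : Finset α⦄, s ∈ P → s ⊆ t → t ⊆ U → t ∈ P

/-- The 'disagreeing' family: `t ∈ P, U \ t ∈ Q` or `t ∈ Q, U \ t ∈ P` (for two petals: the debtor sets). -/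
def disagree : Finset (Finset α) :=
  U.powerset.filter fun t => (t ∈ P ∧ U \ t ∈ Q) ∨ (t ∈ Q ∧ U \ t ∈ P)

/-- The 'agreeing' family: `t ∈ P ∩ Q` or `U \ t ∈ P ∩ Q` (for two petals: the resolved sets). -/
def agree : Finset (Finset α) :=
  U.powerset.filter fun t => (t ∈ P ∧ t ∈ Q) ∨ (U \ t ∈ P ∧ U \ t ∈ Q)

variable {U P Q}

/-- Membership in the disagreeing family. -/
theorem mem_disagree {t : Finset α} : t ∈ disagree U P Q ↔ t ⊆ U ∧ ((t ∈ P ∧ U \ t ∈ Q) ∨ (t ∈ Q ∧ U \ t ∈ P)) := by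
  unfold disagree; rw [mem_filter, mem_powerset]

/-- Membership in the agreeing family. -/
theorem mem_agree {t : Finset α} : t ∈ agree U P Q ↔ t ⊆ U ∧ ((t ∈ P ∧ t ∈ Q) ∨ (U \ t ∈ P ∧ U \ t ∈ Q)) := by
  unfold agree; rw [mem_filter, mem_powerset]

/-- The invariant of the proof: a switch is available (`F` or `G` in `P ∩ Q`) or `F`, `G` have the same colour. -/
def Good (P Q : Finset (Finset α)) (F G : Finset α) : Prop :=
  (F ∈ P ∧ F ∈ Q) ∨ (G ∈ P ∧ G ∈ Q) ∨ ((F ∈ P ↔ G ∈ P) ∧ (F ∈ Q ↔ G ∈ Q))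

/-- **Main lemma** (induction on the remaining game).  `F = S ∪ evars`, `G = (U \ (S ∪ allvars)) ∪ evars`. -/
theorem force_twoPetal_aux (hP : IsUpperIn U P) (hQ : IsUpperIn U Q) :
    ∀ (lg : List (α × Bool)) (S : Finset α), Fresh lg → allvars lg ⊆ U → S ⊆ U → Disjoint S (allvars lg) →
      Force lg (disagree U P Q) S →
      Good P Q (S ∪ evars lg) ((U \ (S ∪ allvars lg)) ∪ evars lg) →
      Force lg (agree U P Q) S := by
  intro lg
  induction lg with
  | nil =>
    intro S _ _ hSU _ hf hgood
    have hS : S ∈ disagree U P Q := hf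
    change S ∈ agree U P Q
    rw [mem_disagree] at hS
    rw [mem_agree]
    refine ⟨hSU, ?_⟩
    simp only [evars, allvars, union_empty] at hgood
    unfold Good at hgood
    rcases hgood with h | h | ⟨h1, h2⟩
    · exact Or.inl h
    · exact Or.inr h
    · rcases hS.2 with ⟨a, b⟩ | ⟨a, b⟩
      · exact Or.inl ⟨a, h2.mpr b⟩
      · exact Or.inl ⟨h1.mpr b, a⟩
  | cons hd lg ih =>
    obtain ⟨x, q⟩ := hd
    intro S hfr hAU hSU hdis hf hgood
    have hfr' : Fresh lg := hfr.2
    have hxA : x ∉ allvars lg := hfr.1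
    have hxU : x ∈ U := hAU (by simp [allvars])
    have hAU' : allvars lg ⊆ U := fun y hy => hAU (by simp [allvars]; exact Or.inr hy)
    have hxS : x ∉ S := fun h => (disjoint_left.mp hdis h) (by simp [allvars])
    have hxE : x ∉ evars lg := fun h => hxA (evars_subset_allvars lg h)
    have hdis' : Disjoint S (allvars lg) := by
      rw [disjoint_left] at hdis ⊢
      intro y hy hy'
      exact hdis hy (by simp [allvars]; exact Or.inr hy')
    have hdisx : Disjoint (insert x S) (allvars lg) := by
      rw [disjoint_left]
      intro y hy hy'
      rcases mem_insert.mp hy with rfl | hy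
      · exact hxA hy'
      · exact (disjoint_left.mp hdis') hy hy'
    -- the two candidate switch sets at the current position
    set F := S ∪ evars ((x, q) :: lg) with hF
    set G := (U \ (S ∪ allvars ((x, q) :: lg))) ∪ evars ((x, q) :: lg) with hG
    have hFU : F ⊆ U := union_subset hSU ((evars_subset_allvars _).trans hAU)
    have hGU : G ⊆ U := union_subset sdiff_subset ((evars_subset_allvars _).trans hAU)
    -- switch to 1
    by_cases hsw1 : F ∈ P ∧ F ∈ Q
    · refine force_of_upper _ _ S fun T h1 h2 => ?_
      have hTU : T ⊆ U := h2.trans (union_subset hSU hAU)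
      exact mem_agree.mpr ⟨hTU, Or.inl ⟨hP hsw1.1 h1 hTU, hQ hsw1.2 h1 hTU⟩⟩
    -- switch to 0
    by_cases hsw0 : G ∈ P ∧ G ∈ Q
    · refine force_of_lower _ _ S hfr fun T h1 h2 => ?_
      have hTU : T ⊆ U := h2.trans (union_subset hSU (sdiff_subset.trans hAU))
      have hGT : G ⊆ U \ T := by
        intro y hy
        rw [mem_sdiff]
        refine ⟨hGU hy, fun hyT => ?_⟩
        have hy2 := h2 hyT
        rw [hG, mem_union, mem_sdiff, mem_union] at hy
        rcases hy with ⟨-, hy⟩ | hy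
        · rw [not_or] at hy
          rcases mem_union.mp hy2 with h | h
          · exact hy.1 h
          · exact hy.2 (mem_sdiff.mp h).1
        · rcases mem_union.mp hy2 with h | h
          · exact (disjoint_left.mp hdis) h (evars_subset_allvars _ hy)
          · exact (mem_sdiff.mp h).2 hy
      exact mem_agree.mpr ⟨hTU, Or.inr ⟨hP hsw0.1 hGT sdiff_subset, hQ hsw0.2 hGT sdiff_subset⟩⟩
    -- no switch: F and G are each in P ∪ Q (extreme continuations) and have the same colour
    have hFPQ : F ∈ P ∨ F ∈ Q := by
      obtain ⟨T, hT, h1, h2⟩ := exists_low_of_force _ _ _ hf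
      rw [mem_disagree] at hT
      rcases hT.2 with ⟨a, -⟩ | ⟨a, -⟩
      · exact Or.inl (hP a h2 hFU)
      · exact Or.inr (hQ a h2 hFU)
    have hGPQ : G ∈ P ∨ G ∈ Q := by
      obtain ⟨T, hT, h1, h2⟩ := exists_high_of_force _ _ _ hf
      rw [mem_disagree] at hT
      have hsub : U \ T ⊆ G := by
        intro y hy
        rw [mem_sdiff] at hy
        rw [hG, mem_union, mem_sdiff, mem_union]
        by_cases hyE : y ∈ evars ((x, q) :: lg)
        · exact Or.inr hyE
        · refine Or.inl ⟨hy.1, fun h => hy.2 (h1 ?_)⟩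
          rcases h with h | h
          · exact mem_union_left _ h
          · exact mem_union_right _ (mem_sdiff.mpr ⟨h, hyE⟩)
      rcases hT.2 with ⟨-, b⟩ | ⟨-, b⟩
      · exact Or.inr (hQ b hsub hGU)
      · exact Or.inl (hP b hsub hGU)
    have hagree : (F ∈ P ↔ G ∈ P) ∧ (F ∈ Q ↔ G ∈ Q) := by
      unfold Good at hgood
      rcases hgood with h | h | h
      · exact absurd h hsw1
      · exact absurd h hsw0
      · exact h
    -- bookkeeping of F, G for the children
    have hF0 : S ∪ evars lg = F.erase x ∨ S ∪ evars lg = F := by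
      cases q with
      | true => left; rw [hF]; simp only [evars]; rw [union_insert, erase_insert]; intro h; rcases mem_union.mp h with h | h; exact hxS h; exact hxE h
      | false => right; rw [hF]; simp only [evars]
    have key_shrinkF : ∀ F' : Finset α, F' ⊆ F → (F' ∈ P ∨ F' ∈ Q) → ¬ (F' ∈ P ∧ F' ∈ Q) →
        (F' ∈ P ↔ G ∈ P) ∧ (F' ∈ Q ↔ G ∈ Q) := by
      intro F' hsub hpq hnot
      rcases hpq with h | h
      · have hFP : F ∈ P := hP h hsub hFU
        have hGP : G ∈ P := hagree.1.mp hFP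
        have hGQ : G ∉ Q := fun h' => hsw0 ⟨hGP, h'⟩
        have hFQ' : F' ∉ Q := fun h' => hnot ⟨h, h'⟩
        exact ⟨⟨fun _ => hGP, fun _ => h⟩, ⟨fun h' => absurd h' hFQ', fun h' => absurd h' hGQ⟩⟩
      · have hFQ : F ∈ Q := hQ h hsub hFU
        have hGQ : G ∈ Q := hagree.2.mp hFQ
        have hGP : G ∉ P := fun h' => hsw0 ⟨h', hGQ⟩
        have hFP' : F' ∉ P := fun h' => hnot ⟨h', h⟩
        exact ⟨⟨fun h' => absurd h' hFP', fun h' => absurd h' hGP⟩, ⟨fun _ => hGQ, fun _ => h⟩⟩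
    have key_shrinkG : ∀ G' : Finset α, G' ⊆ G → (G' ∈ P ∨ G' ∈ Q) → ¬ (G' ∈ P ∧ G' ∈ Q) →
        (F ∈ P ↔ G' ∈ P) ∧ (F ∈ Q ↔ G' ∈ Q) := by
      intro G' hsub hpq hnot
      rcases hpq with h | h
      · have hGP : G ∈ P := hP h hsub hGU
        have hFP : F ∈ P := hagree.1.mpr hGP
        have hFQ : F ∉ Q := fun h' => hsw1 ⟨hFP, h'⟩
        have hGQ' : G' ∉ Q := fun h' => hnot ⟨h, h'⟩
        exact ⟨⟨fun _ => h, fun _ => hFP⟩, ⟨fun h' => absurd h' hFQ, fun h' => absurd h' hGQ'⟩⟩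
      · have hGQ : G ∈ Q := hQ h hsub hGU
        have hFQ : F ∈ Q := hagree.2.mpr hGQ
        have hFP : F ∉ P := fun h' => hsw1 ⟨h', hFQ⟩
        have hGP' : G' ∉ P := fun h' => hnot ⟨h', h⟩
        exact ⟨⟨fun h' => absurd h' hFP, fun h' => absurd h' hGP'⟩, ⟨fun _ => h, fun _ => hFQ⟩⟩
    have key_growF : ∀ F' : Finset α, F ⊆ F' → F' ⊆ U → ¬ (F' ∈ P ∧ F' ∈ Q) → (F' ∈ P ↔ G ∈ P) ∧ (F' ∈ Q ↔ G ∈ Q) := by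
      intro F' hsub hU hnot
      rcases hFPQ with h | h
      · have h' : F' ∈ P := hP h hsub hU
        have hGP := hagree.1.mp h
        have hGQ : G ∉ Q := fun h'' => hsw0 ⟨hGP, h''⟩
        exact ⟨⟨fun _ => hGP, fun _ => h'⟩, ⟨fun h'' => absurd ⟨h', h''⟩ hnot, fun h'' => absurd h'' hGQ⟩⟩
      · have h' : F' ∈ Q := hQ h hsub hU
        have hGQ := hagree.2.mp h
        have hGP : G ∉ P := fun h'' => hsw0 ⟨h'', hGQ⟩
        exact ⟨⟨fun h'' => absurd ⟨h'', h'⟩ hnot, fun h'' => absurd h'' hGP⟩, ⟨fun _ => hGQ, fun _ => h'⟩⟩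
    have key_growG : ∀ G' : Finset α, G ⊆ G' → G' ⊆ U → ¬ (G' ∈ P ∧ G' ∈ Q) → (F ∈ P ↔ G' ∈ P) ∧ (F ∈ Q ↔ G' ∈ Q) := by
      intro G' hsub hU hnot
      rcases hGPQ with h | h
      · have h' : G' ∈ P := hP h hsub hU
        have hFP := hagree.1.mpr h
        have hFQ : F ∉ Q := fun h'' => hsw1 ⟨hFP, h''⟩
        exact ⟨⟨fun _ => h', fun _ => hFP⟩, ⟨fun h'' => absurd h'' hFQ, fun h'' => absurd ⟨h', h''⟩ hnot⟩⟩
      · have h' : G' ∈ Q := hQ h hsub hU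
        have hFQ := hagree.2.mpr h
        have hFP : F ∉ P := fun h'' => hsw1 ⟨h'', hFQ⟩
        exact ⟨⟨fun h'' => absurd h'' hFP, fun h'' => absurd ⟨h'', h'⟩ hnot⟩, ⟨fun _ => h', fun _ => hFQ⟩⟩
    -- identities for the children's F', G'
    have hG_keep0 : (U \ (S ∪ allvars lg)) ∪ evars lg = if q then G else insert x G := by
      cases q with
      | true =>
        rw [if_pos rfl]
        rw [hG]; simp only [allvars, evars]
        ext y; simp only [mem_union, mem_sdiff, mem_insert]
        constructor
        · rintro (⟨hyU, hy⟩ | hy)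
          · rw [not_or] at hy
            by_cases hyx : y = x
            · exact Or.inr (Or.inl hyx)
            · exact Or.inl ⟨hyU, by rw [not_or, not_or]; exact ⟨hy.1, hyx, hy.2⟩⟩
          · exact Or.inr (Or.inr hy)
        · rintro (⟨hyU, hy⟩ | hy)
          · rw [not_or, not_or] at hy
            exact Or.inl ⟨hyU, by rw [not_or]; exact ⟨hy.1, hy.2.2⟩⟩
          · rcases hy with rfl | hy
            · exact Or.inl ⟨hxU, by rw [not_or]; exact ⟨hxS, hxA⟩⟩
            · exact Or.inr hy
      | false =>
        rw [if_neg Bool.false_ne_true]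
        rw [hG]; simp only [allvars, evars]
        ext y; simp only [mem_union, mem_sdiff, mem_insert]
        constructor
        · rintro (⟨hyU, hy⟩ | hy)
          · rw [not_or] at hy
            by_cases hyx : y = x
            · exact Or.inl hyx
            · exact Or.inr (Or.inl ⟨hyU, by rw [not_or, not_or]; exact ⟨hy.1, hyx, hy.2⟩⟩)
          · exact Or.inr (Or.inr hy)
        · rintro (rfl | ⟨hyU, hy⟩ | hy)
          · exact Or.inl ⟨hxU, by rw [not_or]; exact ⟨hxS, hxA⟩⟩
          · rw [not_or, not_or] at hy
            exact Or.inl ⟨hyU, by rw [not_or]; exact ⟨hy.1, hy.2.2⟩⟩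
          · exact Or.inr hy
    have hG_one : (U \ (insert x S ∪ allvars lg)) ∪ evars lg = if q then G.erase x else G := by
      cases q with
      | true =>
        rw [if_pos rfl]
        rw [hG]; simp only [allvars, evars]
        ext y; simp only [mem_union, mem_sdiff, mem_insert, mem_erase]
        constructor
        · rintro (⟨hyU, hy⟩ | hy)
          · rw [not_or, not_or] at hy
            exact ⟨hy.1.1, Or.inl ⟨hyU, by rw [not_or, not_or]; exact ⟨hy.1.2, hy.1.1, hy.2⟩⟩⟩
          · exact ⟨fun h => hxE (h ▸ hy), Or.inr (Or.inr hy)⟩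
        · rintro ⟨hyx, ⟨hyU, hy⟩ | hy⟩
          · rw [not_or, not_or] at hy
            exact Or.inl ⟨hyU, by rw [not_or, not_or]; exact ⟨⟨hyx, hy.1⟩, hy.2.2⟩⟩
          · rcases hy with h | h
            · exact absurd h hyx
            · exact Or.inr h
      | false =>
        rw [if_neg Bool.false_ne_true]
        rw [hG]; simp only [allvars, evars]
        ext y; simp only [mem_union, mem_sdiff, mem_insert]
        constructor
        · rintro (⟨hyU, hy⟩ | hy)
          · rw [not_or, not_or] at hy
            exact Or.inl ⟨hyU, by rw [not_or, not_or]; exact ⟨hy.1.2, hy.1.1, hy.2⟩⟩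
          · exact Or.inr hy
        · rintro (⟨hyU, hy⟩ | hy)
          · rw [not_or, not_or] at hy
            exact Or.inl ⟨hyU, by rw [not_or, not_or]; exact ⟨⟨hy.2.1, hy.1⟩, hy.2.2⟩⟩
          · exact Or.inr hy
    have hF_keep0 : S ∪ evars lg = if q then F.erase x else F := by
      cases q with
      | true =>
        rw [if_pos rfl]; rw [hF]; simp only [evars]
        rw [union_insert, erase_insert]
        intro h; rcases mem_union.mp h with h | h
        · exact hxS h
        · exact hxE h
      | false => rw [if_neg Bool.false_ne_true]; rw [hF]; simp only [evars]
    have hF_one : insert x S ∪ evars lg = if q then F else insert x F := by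
      cases q with
      | true => rw [if_pos rfl]; rw [hF]; simp only [evars]; rw [insert_union, union_insert]
      | false => rw [if_neg Bool.false_ne_true]; rw [hF]; simp only [evars]; rw [insert_union]
    -- now split on who moves
    cases q with
    | true =>
      simp only [Force] at hf ⊢
      rw [if_pos rfl] at hG_keep0 hG_one hF_keep0 hF_one
      rcases hf with hf0 | hf1
      · -- Verifier plays 0: F shrinks to F.erase x, G unchanged
        left
        refine ih S hfr' hAU' hSU hdis' hf0 ?_
        rw [hF_keep0, hG_keep0]
        unfold Good
        by_cases hsw : (F.erase x ∈ P ∧ F.erase x ∈ Q)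
        · exact Or.inl hsw
        · right; right
          have hpq : F.erase x ∈ P ∨ F.erase x ∈ Q := by
            obtain ⟨T, hT, h1, h2⟩ := exists_low_of_force _ _ _ hf0
            rw [mem_disagree] at hT
            rw [hF_keep0] at h2
            have hU' : F.erase x ⊆ U := (erase_subset x F).trans hFU
            rcases hT.2 with ⟨a, -⟩ | ⟨a, -⟩
            · exact Or.inl (hP a h2 hU')
            · exact Or.inr (hQ a h2 hU')
          exact key_shrinkF _ (erase_subset x F) hpq hsw
      · -- Verifier plays 1: F unchanged, G shrinks to G.erase x
        right
        refine ih (insert x S) hfr' hAU' (insert_subset hxU hSU) hdisx hf1 ?_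
        rw [hF_one, hG_one]
        unfold Good
        by_cases hsw : (G.erase x ∈ P ∧ G.erase x ∈ Q)
        · exact Or.inr (Or.inl hsw)
        · right; right
          have hpq : G.erase x ∈ P ∨ G.erase x ∈ Q := by
            obtain ⟨T, hT, h1, h2⟩ := exists_high_of_force _ _ _ hf1
            rw [mem_disagree] at hT
            have hsub : U \ T ⊆ G.erase x := by
              intro y hy
              rw [mem_sdiff] at hy
              rw [← hG_one, mem_union, mem_sdiff, mem_union]
              by_cases hyE : y ∈ evars lg
              · exact Or.inr hyE
              · refine Or.inl ⟨hy.1, fun h => hy.2 (h1 ?_)⟩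
                rcases h with h | h
                · exact mem_union_left _ h
                · exact mem_union_right _ (mem_sdiff.mpr ⟨h, hyE⟩)
            have hU' : G.erase x ⊆ U := (erase_subset x G).trans hGU
            rcases hT.2 with ⟨-, b⟩ | ⟨-, b⟩
            · exact Or.inr (hQ b hsub hU')
            · exact Or.inl (hP b hsub hU')
          exact key_shrinkG _ (erase_subset x G) hpq hsw
    | false =>
      simp only [Force] at hf ⊢
      rw [if_neg Bool.false_ne_true] at hG_keep0 hG_one hF_keep0 hF_one
      refine ⟨?_, ?_⟩
      · -- Adversary plays 0: F unchanged, G grows to insert x G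
        refine ih S hfr' hAU' hSU hdis' hf.1 ?_
        rw [hF_keep0, hG_keep0]
        unfold Good
        by_cases hsw : (insert x G ∈ P ∧ insert x G ∈ Q)
        · exact Or.inr (Or.inl hsw)
        · right; right
          exact key_growG _ (subset_insert x G) (insert_subset hxU hGU) hsw
      · -- Adversary plays 1: F grows to insert x F, G unchanged
        refine ih (insert x S) hfr' hAU' (insert_subset hxU hSU) hdisx hf.2 ?_
        rw [hF_one, hG_one]
        unfold Good
        by_cases hsw : (insert x F ∈ P ∧ insert x F ∈ Q)
        · exact Or.inl hsw
        · right; right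
          exact key_growF _ (subset_insert x F) (insert_subset hxU hFU) hsw

/-- **Two-petal order-shattering domination** (hp-7 gen 83).  For up-sets `P, Q` of subsets of `U` and ANY play order / quantifier
pattern `lg` enumerating the coordinates of `U` (each once): if Verifier can force the disagreeing family she can force the agreeing
family. -/
theorem force_twoPetal (hP : IsUpperIn U P) (hQ : IsUpperIn U Q) (lg : List (α × Bool)) (hfr : Fresh lg) (hU : allvars lg = U)
    (h : Force lg (disagree U P Q) ∅) : Force lg (agree U P Q) ∅ := by
  refine force_twoPetal_aux hP hQ lg ∅ hfr (hU ▸ subset_refl _) (empty_subset U) (disjoint_empty_left _) h ?_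
  unfold Good
  right; right
  rw [empty_union, empty_union, hU, sdiff_self, bot_eq_empty, empty_union]
  exact ⟨Iff.rfl, Iff.rfl⟩

end TwoPetal

end TwoPetalGame

end Summit.CriticalPhenomena.PercolationContinuityZ3.Theorems
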